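import Summits.BirchSwinnertonDyer.BirchSwinnertonDyer.Theorems.PrintCf2DisegniPairTwoChiPairingSeam
import HarnessLib

/-!
# Road (C) `disegni-pair-two` on crux stmt-BirchSwinnertonDyer-20368 — the SIGN FRAME of the tower
# `E′ ⊂ H = E′(t)`: the relative Galois group `Gal(H/E′) ≤ Aut(H/ℚ)` and its sign character EXIST by name

Cell `bsd-print-cf2` (`run/shared/lean/pub/bsd-print-cf2/`), width seat `bsd-line-cf2-p1-w8` g22; companion of
`PrintCf2DisegniPairTwoChiPairingSeam[Tower].lean`. `--supports stmt-BirchSwinnertonDyer-20368` (helper). THEOREMS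
ONLY (no `def`, no named fact, no `sorry`). BSD is not proved by any of this; no summit statement is claimed.

Disegni's predicate `ChiLineGrossZagierClauses ι K W H f a χ_H 𝔭 𝔭′ G χ DH` takes the group `G ≤ Aut(H/ℚ)`
«standing for `Gal(H/K)`» and the character `χ : G →* ℂˣ` as PARAMETERS. For road (C) (`K = E′`, `H = E′(t)`,
`t² = d*`, `χ_H = ε_{d*}∘N_{E′}`) they are `G = Gal(H/E′)` and the SIGN character `χ(σ) = σ(t)/t ∈ {±1}`. A
skeleton cannot introduce definitions, so this file delivers both as an EXISTENCE statement to `obtain` from: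

* `apply_gen_eq_self_or_eq_neg` — an automorphism of `H` fixing `E′` sends `t` (`t² ∈ E′`) to `±t`;
* ★ `exists_relGal_signCharacter` — there are `G : Subgroup (H ≃ₐ[ℚ] H)`, `χ : G →* ℂˣ` and `s : G → ℤ` with:
  membership in `G` ⟺ fixing `E′` pointwise; `χ(σ) = s(σ)` (the hypothesis `hs` of the seam files); and for every
  `σ ∈ G` either `σt = t ∧ s(σ) = 1` or `σt = −t ∧ s(σ) = −1`. With `exists_algEquiv_tower` (file `…SeamTower`) the
  `E′`-conjugation `τ` lies in `G` with `s(τ) = −1` (`mem_and_sign_of_apply_eq_neg`), which is exactly the input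
  `(hτG, hsτ)` of `exists_rat_chiPairings_eq[_tower]`.

References: D. Disegni, Compos. Math. 153 (2017) §1.1.1 (`χ` a character of `Gal(E^{ab}/E)`), Thm. B [Disegni2017];
J. H. Silverman, AEC (2009) X.2 (the quadratic character of a twist) [SilvermanAEC2009].
-/

set_option autoImplicit false
set_option linter.dupNamespace false

noncomputable section

open scoped Classical

namespace Summit.BirchSwinnertonDyer.BirchSwinnertonDyer.Theorems.PrintCf2.DisegniPairTwo

section SignFrame

variable {E H : Type} [Field E] [Field H] [Algebra E H]

/-- An automorphism of `H` fixing `E′` pointwise sends a square root `t` of an element of `E′` to `±t`.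
[cite: SilvermanAEC2009, X.2 Prop. 2.4] -/
theorem apply_gen_eq_self_or_eq_neg [Algebra ℚ H] {t : H} {d' : E} (htd : t ^ 2 = algebraMap E H d')
    (σ : H ≃ₐ[ℚ] H)
    (hσE : ∀ a : E, σ (algebraMap E H a) = algebraMap E H a) : σ t = t ∨ σ t = -t := by
  have h : σ t ^ 2 = t ^ 2 := by rw [← map_pow, htd, hσE]
  have h0 : (σ t - t) * (σ t + t) = 0 := by linear_combination h
  rcases mul_eq_zero.mp h0 with h1 | h1
  · exact Or.inl (sub_eq_zero.mp h1)
  · exact Or.inr (eq_neg_of_add_eq_zero_left h1)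

/-- In characteristic zero `−t ≠ t` for `t ≠ 0`. [folklore] -/
theorem neg_ne_self_of_ne_zero [CharZero H] {t : H} (ht0 : t ≠ 0) : -t ≠ t := by
  intro h
  apply ht0
  have h2 : (2 : H) * t = 0 := by linear_combination -h
  rcases mul_eq_zero.mp h2 with h3 | h3
  · exact absurd h3 two_ne_zero
  · exact h3

/-- ★ **The relative Galois group `Gal(H/E′) ≤ Aut(H/ℚ)` and its SIGN character exist by name.** For a tower
`E′ ⊂ H` of fields of characteristic zero and `t ∈ H`, `t ≠ 0`, `t² ∈ E′`: there are a subgroup `G` of `Aut(H/ℚ)`,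
a character `χ : G →* ℂˣ` and an integer-valued `s` on `G` such that (i) `σ ∈ G ⟺ σ` fixes `E′` pointwise,
(ii) `χ(σ) = s(σ)` in `ℂ`, (iii) every `σ ∈ G` has `σt = t, s(σ) = 1` or `σt = −t, s(σ) = −1` — i.e. `χ(σ) = σ(t)/t`,
the character through which `ε_{d*}∘N_{E′}` is read on `Gal(E′(√d*)/E′)`.
[cite: Disegni2017, §1.1.1 (arXiv v3 PDF p. 3 L32–40)] [cite: SilvermanAEC2009, X.2 Prop. 2.4] -/
theorem exists_relGal_signCharacter [CharZero H] [Algebra ℚ H] {t : H} {d' : E}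
    (htd : t ^ 2 = algebraMap E H d') (ht0 : t ≠ 0) :
    ∃ (G : Subgroup (H ≃ₐ[ℚ] H)) (χ : G →* ℂˣ) (s : G → ℤ),
      (∀ σ : H ≃ₐ[ℚ] H, σ ∈ G ↔ ∀ a : E, σ (algebraMap E H a) = algebraMap E H a) ∧
      (∀ σ : G, ((χ σ : ℂˣ) : ℂ) = (s σ : ℂ)) ∧
      (∀ σ : G, (σ.1 t = t ∧ s σ = 1) ∨ (σ.1 t = -t ∧ s σ = -1)) := by
  -- the subgroup of automorphisms fixing `E′`
  let G : Subgroup (H ≃ₐ[ℚ] H) :=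
    { carrier := {σ | ∀ a : E, σ (algebraMap E H a) = algebraMap E H a}
      one_mem' := fun a => rfl
      mul_mem' := fun {σ τ} hσ hτ a => by
        show σ (τ (algebraMap E H a)) = algebraMap E H a
        rw [hτ a, hσ a]
      inv_mem' := fun {σ} hσ a => by
        show σ.symm (algebraMap E H a) = algebraMap E H a
        conv_lhs => rw [← hσ a]
        exact σ.symm_apply_apply _ }
  have hG : ∀ σ : H ≃ₐ[ℚ] H, σ ∈ G ↔ ∀ a : E, σ (algebraMap E H a) = algebraMap E H a := fun σ => Iff.rfl
  have hpm : ∀ σ : G, σ.1 t = t ∨ σ.1 t = -t := fun σ =>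
    apply_gen_eq_self_or_eq_neg htd σ.1 ((hG σ.1).mp σ.2)
  have hne : -t ≠ t := neg_ne_self_of_ne_zero ht0
  -- the sign character
  let f : G → ℂˣ := fun σ => if σ.1 t = t then 1 else -1
  have hf_mul : ∀ σ τ : G, f (σ * τ) = f σ * f τ := fun σ τ => by
    have hστ : (σ * τ).1 t = σ.1 (τ.1 t) := rfl
    simp only [f, hστ]
    rcases hpm τ with hτ | hτ <;> rcases hpm σ with hσ | hσ
    · rw [hτ, hσ]; simp
    · rw [hτ, hσ]; simp [hne]
    · rw [hτ, map_neg, hσ]; simp [hne]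
    · rw [hτ, map_neg, hσ, neg_neg]; simp [hne]
  let χ : G →* ℂˣ := MonoidHom.mk' f hf_mul
  refine ⟨G, χ, fun σ => if σ.1 t = t then 1 else -1, hG, fun σ => ?_, fun σ => ?_⟩
  · show ((f σ : ℂˣ) : ℂ) = _
    simp only [f]
    split_ifs <;> simp
  · rcases hpm σ with h | h
    · exact Or.inl ⟨h, by simp [h]⟩
    · exact Or.inr ⟨h, by simp [h, hne]⟩

/-- Reading the package: an element `τ` fixing `E′` with `τt = −t` lies in `G` and has `s(τ) = −1` — the inputs
`hτG`, `hsτ` of `exists_rat_chiPairings_eq[_tower]`. [cite: Disegni2017, §1.1.1 (arXiv v3 PDF p. 3 L32–40)] -/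
theorem mem_and_sign_of_apply_eq_neg [CharZero H] [Algebra ℚ H] {t : H} (ht0 : t ≠ 0)
    {G : Subgroup (H ≃ₐ[ℚ] H)} {s : G → ℤ}
    (hG : ∀ σ : H ≃ₐ[ℚ] H, σ ∈ G ↔ ∀ a : E, σ (algebraMap E H a) = algebraMap E H a)
    (hsign : ∀ σ : G, (σ.1 t = t ∧ s σ = 1) ∨ (σ.1 t = -t ∧ s σ = -1))
    (τ : H ≃ₐ[ℚ] H) (hτE : ∀ a : E, τ (algebraMap E H a) = algebraMap E H a) (hτt : τ t = -t) :
    ∃ hτG : τ ∈ G, s ⟨τ, hτG⟩ = -1 := by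
  refine ⟨(hG τ).mpr hτE, ?_⟩
  rcases hsign ⟨τ, (hG τ).mpr hτE⟩ with ⟨h, _⟩ | ⟨_, h⟩
  · exact absurd (hτt.symm.trans h) (neg_ne_self_of_ne_zero ht0)
  · exact h

/-- A square root `t ∉ E′` is non-zero (convenience for `exists_relGal_signCharacter`). [folklore] -/
theorem ne_zero_of_not_mem_range {t : H} (htE : t ∉ Set.range (algebraMap E H)) : t ≠ 0 :=
  fun h => htE ⟨0, by rw [map_zero, h]⟩

end SignFrame

end Summit.BirchSwinnertonDyer.BirchSwinnertonDyer.Theorems.PrintCf2.DisegniPairTwo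

end
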